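import Literature.NumberTheory.ConnesConsani2021.JumpFormula
import Summits.RiemannHypothesis.RiemannHypothesis.Theorems.SoninSignKernel
import HarnessLib

/-!
# The Sonin sign mechanism, III — Connes–Consani's Theorem 1 near the identity needs ONE condition

Third file of the chain (seat cc-s2-1 gen 6, Lean lane item L2).  In the style — and with exactly the
hypothesis SHAPE — of `Literature.NumberTheory.ConnesConsani2021.MainInequalityAssembly`
(`weilArchPositivity_soninTrace_of_perp`): the residual printed input is CC 2021's trace formula
(Thm. 3 / 4.7) in weak form, (H-TF) `Σ_i Re⟨ξ_i|ϑ(f∗f*)ξ_i⟩ ≤ Re W_∞(f∗f*) + Re E₊(f∗f*)` with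
`E₊(F) = ∫ F(x) g(|x|) dx` (`evenFunctional`, CC's `ε∘exp = g`).  MainInequalityAssembly then needs the
§6 spectral data of the window operator `𝐊_I` (one eigenvalue above `1` at `|I| = log 2`, floating
point in print) and BOTH vanishing conditions.  Here instead:

* `evenFunctional_weilConv_eq_pairP` — `E₊(f ⋆ f̃) = ∫∫ g(|u−v|) f(u) conj f(v) du dv` (PROVED);
* `soninTrace_le_archW_oneCondition_of_shape` — **if `g ∈ C²` is nondecreasing and concave on
  `[0, 2a]` (`g″ ≤ 0` there, `g′(2a) ≥ 0`) then (H-TF) on the window `[−a, a]` already gives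
  `Σ_i Re⟨ξ_i|ϑ(f∗f*)ξ_i⟩ ≤ Re W_∞(f∗f*)` for every test `f` supported in `[−a, a]` with the SINGLE
  condition `f̂(0) = ∫f = 0`** — no second condition, no spectral computation: `E₊(f⋆f̃) ≤ 0` by the
  CND theorem of file II applied to `φ = g − g(0)`.

What it says about CC 2021: the cusp of `ε` at `ρ = 1` (slope `ε′(1₊) ≃ 22.9965`, §5 p. 20; `ε∘exp`
concave up to and past its maximum at `ρ ≈ 1.24` — cell DATA, kit j169370) is by itself the positive
mechanism on windows of log-half-width `≤ 0.1075` (the cell's "Pólya radius"); the one eigenvalue of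
`𝐊_I` above `1` and the second condition are features of the outer part of CC's window `(log 2)/2`.
The shape hypothesis is a statement about an explicit prolate series (certifiable by interval
arithmetic); the trace formula stays a hypothesis exactly as in MainInequalityAssembly.  Framing:
structure, not an RH claim; nothing here discharges `WeilArchPositivity_soninTrace`.
-/

set_option linter.dupNamespace false  -- the mandated namespace repeats `RiemannHypothesis`

noncomputable section

open MeasureTheory Set intervalIntegral Complex
open Literature.NumberTheory.LFunctions Literature.NumberTheory.ConnesConsani2021
open scoped ComplexConjugate

namespace Summit.RiemannHypothesis.RiemannHypothesis.SoninSign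

/-- **CC's remainder functional is a pair form**: for the even density `x ↦ g(|x|)` and `F = f ⋆ f̃`,
`E₊(F) = ∫ F(x) g(|x|) dx = ∫∫ g(|u−v|) f(u) conj f(v) du dv`. [cite: ConnesConsani2021, eq. (Eprime) §5 p. 20; Thm. 6.11 proof p. 29 (`E(f) = E₊(…)` for `f = g ∗ g*`)] -/
theorem evenFunctional_weilConv_eq_pairP {f : ℝ → ℂ} (hf : Continuous f) (hfs : HasCompactSupport f)
    {g : ℝ → ℝ} (hg : Continuous g) :
    evenFunctional (fun x => ((g x : ℝ) : ℂ)) (weilConv f (weilReflect f)) =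
      ∫ p : ℝ × ℝ, ((g |p.1 - p.2| : ℝ) : ℂ) * (f p.1 * conj (f p.2)) := by
  -- unfold to a double integral in (x, u)
  have hconv : ∀ x, weilConv f (weilReflect f) x = ∫ u, f u * conj (f (u - x)) := by
    intro x
    rw [weilConv_apply]
    refine integral_congr_ae (Filter.Eventually.of_forall fun u => ?_)
    simp [weilReflect, neg_sub]
  obtain ⟨M, hM⟩ := (hfs.isCompact.isBounded).subset_closedBall 0
  have hsuppf : ∀ x, f x ≠ 0 → x ∈ Icc (-M) M := by
    intro x hx
    have := hM (subset_tsupport f hx)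
    rwa [Real.closedBall_eq_Icc, zero_sub, zero_add] at this
  -- integrability of (x, u) ↦ f u conj f(u − x) g|x|
  set Φ : ℝ → ℝ → ℂ := fun x u => f u * conj (f (u - x)) * ((g |x| : ℝ) : ℂ) with hΦ
  have hΦc : Continuous (Function.uncurry Φ) := by
    simp only [hΦ]
    exact ((hf.comp continuous_snd).mul
      (Complex.continuous_conj.comp (hf.comp (continuous_snd.sub continuous_fst)))).mul
      (Complex.continuous_ofReal.comp (hg.comp continuous_fst.abs))
  have hΦs : HasCompactSupport (Function.uncurry Φ) := by
    refine HasCompactSupport.intro ((isCompact_Icc (a := -(2*M)) (b := 2*M)).prod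
      (isCompact_Icc (a := -M) (b := M))) ?_
    intro q hq
    simp only [hΦ, Function.uncurry]
    by_contra hne
    have h1 : f q.2 ≠ 0 := fun h => hne (by simp [h])
    have h2 : f (q.2 - q.1) ≠ 0 := fun h => hne (by simp [h])
    have hu := hsuppf _ h1
    have hv := hsuppf _ h2
    exact hq (Set.mem_prod.2 ⟨⟨by linarith [hu.1, hu.2, hv.1, hv.2], by linarith [hu.1, hu.2, hv.1, hv.2]⟩, hu⟩)
  have hInt : Integrable (Function.uncurry Φ) ((volume : Measure ℝ).prod volume) :=
    hΦc.integrable_of_hasCompactSupport hΦs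
  -- E₊(F) = ∫_x ∫_u Φ
  have hE : evenFunctional (fun x => ((g x : ℝ) : ℂ)) (weilConv f (weilReflect f)) = ∫ x, ∫ u, Φ x u := by
    rw [evenFunctional_apply]
    refine integral_congr_ae (Filter.Eventually.of_forall fun x => ?_)
    simp only [hΦ]
    rw [hconv x, ← MeasureTheory.integral_mul_const]
  rw [hE, MeasureTheory.integral_integral_swap hInt]
  -- inner x-integral: substitute x = u − v
  have hinner : ∀ u, ∫ x, Φ x u = f u * ∫ v, conj (f v) * ((g |u - v| : ℝ) : ℂ) := by
    intro u
    simp only [hΦ]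
    rw [← MeasureTheory.integral_const_mul]
    have := integral_sub_left_eq_self (fun x => f u * (conj (f (u - x)) * ((g |x| : ℝ) : ℂ))) volume u
    simp only [sub_sub_cancel] at this
    calc ∫ x, f u * conj (f (u - x)) * ((g |x| : ℝ) : ℂ)
        = ∫ x, f u * (conj (f (u - x)) * ((g |x| : ℝ) : ℂ)) :=
          integral_congr_ae (Filter.Eventually.of_forall fun x => by ring)
      _ = ∫ x, f u * (conj (f x) * ((g |u - x| : ℝ) : ℂ)) := this.symm
  simp_rw [hinner]
  -- back to the product integral
  rw [show (volume : Measure (ℝ × ℝ)) = (volume : Measure ℝ).prod (volume : Measure ℝ) from rfl,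
    integral_prod _ (integrable_pair hf hfs (k := fun x => g |x|) (hg.comp continuous_abs))]
  refine integral_congr_ae (Filter.Eventually.of_forall fun u => ?_)
  show f u * ∫ v, conj (f v) * ((g |u - v| : ℝ) : ℂ) = ∫ y, ((g |u - y| : ℝ) : ℂ) * (f u * conj (f y))
  rw [← MeasureTheory.integral_const_mul]
  refine integral_congr_ae (Filter.Eventually.of_forall fun v => ?_)
  ring

/-- **The sign mechanism as a theorem (Connes–Consani 2021, Thm. 1 near the identity, ONE condition).**
Assume CC's trace formula in weak form on the window `[−a, a]` with an even remainder density
`x ↦ g(|x|)` ((H-TF), exactly the hypothesis shape of `MainInequalityAssembly`), and assume only the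
SHAPE of the density on the window: `g ∈ C²`, `g″ ≤ 0` on `[0, 2a]` and `g′(2a) ≥ 0` (so `g` is
nondecreasing and concave on `[0, 2a]` — for CC's `ε∘exp` this is the cusp at `ρ = 1`, slope
`ε′(1₊) ≃ 22.9965`, up to the maximum of `ε`).  Then for every test `f` supported in `[−a, a]` with
the SINGLE vanishing condition `f̂(0) = 0` and every finite orthonormal family in Sonin's space:
`Σ_i Re⟨ξ_i|ϑ(f ∗ f*)ξ_i⟩ ≤ Re W_∞(f ∗ f*)` — no second condition, no spectral computation: the
remainder functional is conditionally negative definite (`re_integral_prod_kernel_nonpos_of_concave`).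
[cite: ConnesConsani2021, Thm. 1 (Intro p. 4); Thm. 3 / 4.7 (the trace formula used as (H-TF)); §5 p. 20 (ε′(1₊))] -/
theorem soninTrace_le_archW_oneCondition_of_shape {g : ℝ → ℝ} (hg : ContDiff ℝ 2 g) {a : ℝ}
    (ha : 0 ≤ a) (hmono : 0 ≤ deriv g (2 * a)) (hconc : ∀ s ∈ Icc 0 (2 * a), deriv (deriv g) s ≤ 0)
    (hTr : ∀ f : ℝ → ℂ, IsWeilTest f → tsupport f ⊆ Icc (-a) a →
      ∀ (n : ℕ) (ξ : Fin n → Lp ℂ 2 (volume : Measure ℝ)),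
        Orthonormal ℂ ξ → (∀ i, ξ i ∈ soninSpace 1 1) →
          ∑ i, (soninTraceForm (weilConv f (weilReflect f)) (ξ i : ℝ → ℂ)).re
            ≤ (archW (weilConv f (weilReflect f))).re
              + (evenFunctional (fun x => ((g x : ℝ) : ℂ)) (weilConv f (weilReflect f))).re)
    {f : ℝ → ℂ} (hf : IsWeilTest f) (hfs : tsupport f ⊆ Icc (-a) a) (h0 : mulFourier f 0 = 0)
    (n : ℕ) (ξ : Fin n → Lp ℂ 2 (volume : Measure ℝ)) (hξ : Orthonormal ℂ ξ)
    (hS : ∀ i, ξ i ∈ soninSpace 1 1) :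
    ∑ i, (soninTraceForm (weilConv f (weilReflect f)) (ξ i : ℝ → ℂ)).re
      ≤ (archW (weilConv f (weilReflect f))).re := by
  have hfc : Continuous f := hf.1.continuous
  have hint0 : ∫ u, f u = 0 := by rw [← mulFourier_zero_eq_integral]; exact h0
  -- the pair form of a real kernel k against f (local abbreviation)
  set P : (ℝ → ℝ) → ℂ := fun k => ∫ p : ℝ × ℝ, ((k (p.1 - p.2) : ℝ) : ℂ) * (f p.1 * conj (f p.2)) with hP
  -- E₊(f ⋆ f̃) as a pair form, then split g(|x|) = g(0) + ∫₀^{|x|} g′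
  have hE := evenFunctional_weilConv_eq_pairP hfc hf.2 hg.continuous
  have hg1 : ContDiff ℝ 1 (deriv g) := hg.deriv'
  have hFTC : ∀ x : ℝ, g |x| = g 0 + ∫ t in (0:ℝ)..|x|, deriv g t := by
    intro x
    rw [intervalIntegral.integral_deriv_eq_sub (fun t _ => (hg.differentiable (by simp)).differentiableAt)
      ((hg.continuous_deriv (by simp)).intervalIntegrable _ _)]
    ring
  have I1 : Integrable (fun p : ℝ × ℝ => ((g 0 : ℝ) : ℂ) * (f p.1 * conj (f p.2))) :=
    integrable_pair hfc hf.2 (k := fun _ => g 0) continuous_const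
  have hk2 : Continuous (fun x : ℝ => ∫ t in (0:ℝ)..|x|, deriv g t) :=
    intervalIntegral.continuous_parametric_intervalIntegral_of_continuous (a₀ := 0)
      (f := fun (_ : ℝ) t => deriv g t) ((hg.continuous_deriv (by simp)).comp continuous_snd)
      continuous_abs
  have I2 : Integrable (fun p : ℝ × ℝ => ((∫ t in (0:ℝ)..|p.1 - p.2|, deriv g t : ℝ) : ℂ) *
      (f p.1 * conj (f p.2))) :=
    integrable_pair hfc hf.2 (k := fun x => ∫ t in (0:ℝ)..|x|, deriv g t) hk2
  have hsplit : P (fun x => g |x|) =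
      P (fun _ => g 0) + P (fun x => ∫ t in (0:ℝ)..|x|, deriv g t) := by
    simp only [hP]
    rw [← integral_add I1 I2]
    refine integral_congr_ae (Filter.Eventually.of_forall fun p => ?_)
    show (((g |p.1 - p.2| : ℝ)) : ℂ) * (f p.1 * conj (f p.2)) = _
    rw [hFTC]
    push_cast
    ring
  have hconst : P (fun _ => g 0) = 0 := by
    simp only [hP]
    have hpm : (∫ p : ℝ × ℝ, f p.1 * conj (f p.2)) = (∫ u, f u) * conj (∫ v, f v) := by
      rw [← integral_conj]
      exact MeasureTheory.integral_prod_mul (μ := (volume : Measure ℝ)) (ν := (volume : Measure ℝ))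
        f (fun v => conj (f v))
    rw [MeasureTheory.integral_const_mul, hpm, hint0, zero_mul, mul_zero]
  have hsupp' : tsupport f ⊆ Icc (-a) (-a + 2 * a) := by
    convert hfs using 2; ring
  have hneg := re_integral_prod_kernel_nonpos_of_concave (G := f) hg1 (by linarith : (0:ℝ) ≤ 2 * a)
    hmono hconc hfc hf.2 hsupp' hint0
  have hEP : evenFunctional (fun x => ((g x : ℝ) : ℂ)) (weilConv f (weilReflect f)) = P (fun x => g |x|) := by
    rw [hE]
  have hEre : (evenFunctional (fun x => ((g x : ℝ) : ℂ)) (weilConv f (weilReflect f))).re ≤ 0 := by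
    rw [hEP, hsplit, hconst, zero_add]
    exact hneg
  linarith [hTr f hf hfs n ξ hξ hS]

end Summit.RiemannHypothesis.RiemannHypothesis.SoninSign
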